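import Literature.AnabelianGeometry.EtaleTheta.ThetaSettingZNFromSplitting
import Literature.AnabelianGeometry.EtaleTheta.Thm16SubdagAssembly
import Literature.AnabelianGeometry.EtaleTheta.ThetaCohomologyInversion
import Literature.AnabelianGeometry.EtaleTheta.Discharge.Sec1AutPreservesDeltaTemp
import Literature.AnabelianGeometry.EtaleTheta.Discharge.Sec1Thm16Carriers
import HarnessLib

/-!
# [EtTh] §1 p. 14 / Thm. 1.6: `γ(Π^tp_{Z_N,α}) = Π^tp_{Z_N,β}` from print's CONSTRUCTION of `Z_N`
# (the covering clause hZN as a THEOREM of the origin clause `GtpZNFromSplitting`)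

Mochizuki, *The étale theta function and its Frobenioid-theoretic manifestations*, Publ. RIMS **45**
(2009), §1, PRIMS PDF p. 14 (printed 240; kurims p. 13): "we have an exact sequence
`1 → Δ_Θ ⊗ ℤ/Nℤ → (Π^tp_{Y_N})^Θ/N·(Δ^tp_Y)^Θ → G_{K_N} → 1` … Since any two splittings of this exact
sequence differ by a cohomology class `∈ H¹(G_{K_N}, ℤ/Nℤ(1))`, it follows [by the definition of `J_N`]
that all splittings of this exact sequence determine the same splitting over `G_{J_N}`. Thus, the image
of the resulting open immersion `G_{J_N} ↪ (Π^tp_{Y_N})^Θ/N·(Δ^tp_Y)^Θ` is stabilized by the conjugation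
action of `Π^tp_X`, hence determines a Galois covering `Z_N → Y_N` … whose kernel we denote by
`Π^tp_{Z_N}`" [cite: MochizukiEtTh2009, §1 p.14]; Thm. 1.6 (i) p. 24 [cite: MochizukiEtTh2009, Thm 1.6 (i) p.24].

abc-iut cell, layer L2, seat abc-iut-L2-t1 (§1 ROOT owner, gen 6). PROOF-ONLY companion (no
definition, no `Prop`-valued definition, no new named fact) of the gen-5 origin-clause file
`ThetaSettingZNFromSplitting.lean` (p446335: `thetaPowersY`, `IsThetaSplittingAt`, `GtpZNFromSplitting`),
of abc-iut-L6-d5's `Thm16SubdagAssembly.lean` (p418748: `map_DtpY_eq`, `map_GtpYN_eq_of_inputs` — the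
`Y_N`-twin, consumed BY NAME) and of `ThetaCohomologyInversion.lean` (p437774: `IsInversionAut`). The
covering clause **hZN** `∀ N, (Dα.GtpZN N).map γ = Dβ.GtpZN N` — a HYPOTHESIS of
`IsInversionAut.transport` / `Thm16Sub.thm16iii_of_prop15iiiInv` (p445347; plan/L2/K3-RESIDUAL-GAPS.md
addendum v2.1: "hZN … has NO origin clause in tree") — becomes a THEOREM of the printed construction:
* `Thm16Sub.aug_map_eq_iff` — under (hΔ), `aug_β(γ g) = aug_β(γ g') ↔ aug_α(g) = aug_α(g')`;
* `Thm16Sub.map_DtpYTheta_eq`, **`map_thetaPowersY_eq`** — a theta companion `γ^Θ` carries `(Δ^tp_{Yα})^Θ`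
  and `N·(Δ^tp_{Yα})^Θ` onto their `β`-counterparts (from (hΔ) and `γ(Π^tp_{Yα}) = Π^tp_{Yβ}`);
* **`Thm16Sub.exists_transport_splitting`** — a lifted splitting `s_α` over `G_{K_N,α}` transports along
  `(γ, γ^Θ)` to `s_β := γ^Θ ∘ s_α ∘ φ`, `φ(σ′) := aug_α(γ⁻¹ g′)` for any lift `g′` of `σ′` in `Π^tp_{Y_N,β}`;
* **`Thm16Sub.map_GtpZN_eq_of_exists_splitting`**, **`map_GtpZN_eq_of_splitting`** — hZN at level `N` from:
  a theta companion, (hΔ) ([AbsAnab] Lem. 1.3.8), `γ(Π^tp_{Yα}) = Π^tp_{Yβ}` (leaf L02),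
  `γ(Π^tp_{Y_N,α}) = Π^tp_{Y_N,β}` (L6-d5's theorem of inputs), the transport of "`aug(g) ∈ G_{K_N}`"
  (leaf L04, `haugN`) AND of "`aug(g) ∈ G_{J_N}`" (`haugJN`, the `J_N`-twin of leaf L04: "`G_{J_N}` is
  group-theoretic" — in print the Kummer theory of `K_N` behind "[by the definition of `J_N`]"; a named
  hypothesis, not discharged here), `GtpZNFromSplitting Dβ N`, and on the `α` side only the ∃-form
  "some lifted splitting cuts out `Π^tp_{Z_N,α}`" (the shape of abc-iut-L2-d1's model witness p448964);
* `Thm16Sub.haugN_of_map_GtpYN_eq`, **`haugJN_of_map_GtpZN_eq`** — conversely hYN ⇒ haugN, hZN ⇒ haugJN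
  over the root (`map_aug_GtpYN`, `map_aug_GtpZN`): the new binder is NECESSARY, not idle;
* one setting, an automorphism `ι` over `K` (`aug ∘ ι = aug`; (hΔ), haugN, haugJN free):
  **`Thm16Sub.map_GtpZN_eq_self_of_splitting`** and **`ThetaSetting.isInversionAut_of_originClauses`** —
  the covering fields `map_GtpYN`/`map_GtpZN` of `IsInversionAut` (Prop. 1.5 (iii)) are THEOREMS of the
  clauses `aug/toZ/ell`, a theta companion, `GtpYNFromCusp` (R2) at every level, [SemiAnbd] Thm. 6.5
  (iii) for automorphisms of `Π^tp_X`, a cuspidal decomposition group inside `Π^tp_Y`, and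
  `GtpZNFromSplitting` + a lifted splitting at every level.

HONEST FRAMING: [EtTh] is refereed; nothing asserted; origin clauses and Galois-image transports stay
named hypotheses; typed ≠ proved; nothing here bears on [IUTchIII] Cor. 3.12. (The continuity-refined
clause, FINDING F-L2d1g5-1 / R405, transports by the same construction once `φ` is continuous.)
-/

noncomputable section

namespace Literature.AnabelianGeometry.EtaleTheta

open Literature.AnabelianGeometry.SemiGraphs

namespace Thm16Sub

variable {p : ℕ} [Fact p.Prime]

/-! ### One setting: Galois images of `Π^tp_{Y_N}`, `Π^tp_{Z_N}` (root fields unfolded) -/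

section OneSetting

variable (D : ThetaSetting p)

/-- Every `σ ∈ G_{K_N}` lifts to `Π^tp_{Y_N}` (exactness p. 13; root field `map_aug_GtpYN`).
[cite: MochizukiEtTh2009, §1 p.13] -/
theorem exists_mem_GtpYN_aug_eq (N : ℕ+) {σ : GQp p} (hσ : σ ∈ D.GKN N) :
    ∃ g ∈ D.GtpYN N, D.aug g = σ := by
  have h : σ ∈ (D.GtpYN N).map D.aug.toMonoidHom := by rw [D.map_aug_GtpYN N]; exact hσ
  exact h

/-- Every `σ ∈ G_{J_N}` lifts to `Π^tp_{Z_N}` (exactness p. 14; root field `map_aug_GtpZN`).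
[cite: MochizukiEtTh2009, §1 p.14] -/
theorem exists_mem_GtpZN_aug_eq (N : ℕ+) {σ : GQp p} (hσ : σ ∈ D.GJN N) :
    ∃ g ∈ D.GtpZN N, D.aug g = σ := by
  have h : σ ∈ (D.GtpZN N).map D.aug.toMonoidHom := by rw [D.map_aug_GtpZN N]; exact hσ
  exact h

/-- `aug(Π^tp_{Z_N}) ⊆ G_{J_N}` (p. 14; root field `map_aug_GtpZN`). [cite: MochizukiEtTh2009, §1 p.14] -/
theorem aug_mem_GJN_of_mem_GtpZN (N : ℕ+) {g : D.PiTemp} (hg : g ∈ D.GtpZN N) : D.aug g ∈ D.GJN N := by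
  have h : D.aug.toMonoidHom g ∈ (D.GtpZN N).map D.aug.toMonoidHom := Subgroup.mem_map_of_mem _ hg
  rwa [D.map_aug_GtpZN N] at h

/-- `aug g = aug g'` iff `g⁻¹ g' ∈ Δ^tp_X = Ker(aug)` (p. 12). [cite: MochizukiEtTh2009, §1 p.12] -/
theorem aug_eq_iff_inv_mul_mem (g g' : D.PiTemp) : D.aug g = D.aug g' ↔ g⁻¹ * g' ∈ D.DeltaTemp := by
  change _ ↔ g⁻¹ * g' ∈ D.aug.toMonoidHom.ker
  rw [MonoidHom.mem_ker, map_mul, map_inv, inv_mul_eq_one]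
  exact Iff.rfl

end OneSetting

/-! ### Two settings: the Galois correspondence and the transports along `γ` -/

section TwoSettings

variable (Dα Dβ : ThetaSetting p) (γ : Dα.PiTemp ≃ₜ* Dβ.PiTemp)
  (hΔ : Dα.DeltaTemp.map γ.toMulEquiv.toMonoidHom = Dβ.DeltaTemp)

/-- Membership transport along `γ`: `γ x ∈ γ(S) ↔ x ∈ S`. [cite: MochizukiEtTh2009, Thm 1.6 (i) p.24] -/
theorem mem_map_iff_of_equiv (S : Subgroup Dα.PiTemp) (x : Dα.PiTemp) :
    γ.toMulEquiv x ∈ S.map γ.toMulEquiv.toMonoidHom ↔ x ∈ S := by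
  constructor
  · rintro ⟨x', hx', h⟩
    rwa [← γ.toMulEquiv.injective h]
  · exact fun hx => ⟨x, hx, rfl⟩

include hΔ in
/-- **The Galois correspondence is well defined**: granted `γ(Δ^tp_{Xα}) = Δ^tp_{Xβ}` ([AbsAnab]
Lem. 1.3.8, as in the proof of Thm. 1.6 (i), p. 24), `aug_β(γ g) = aug_β(γ g')` iff
`aug_α(g) = aug_α(g')` — `γ` induces a bijection between the Galois images. [cite: MochizukiEtTh2009, Thm 1.6 (i) p.24] -/
theorem aug_map_eq_iff (g g' : Dα.PiTemp) :
    Dβ.aug (γ.toMulEquiv g) = Dβ.aug (γ.toMulEquiv g') ↔ Dα.aug g = Dα.aug g' := by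
  rw [aug_eq_iff_inv_mul_mem, aug_eq_iff_inv_mul_mem]
  have h : (γ.toMulEquiv g)⁻¹ * γ.toMulEquiv g' = γ.toMulEquiv (g⁻¹ * g') := by
    rw [map_mul, map_inv]
  rw [h, ← hΔ]
  exact mem_map_iff_of_equiv Dα Dβ γ _ _

include hΔ in
/-- If `γ(Π^tp_{Y_N,α}) = Π^tp_{Y_N,β}` then the `G_{K_N}`-membership clause transports (leaf L04's
`haugN` is implied by hYN; `aug(Π^tp_{Y_N}) = G_{K_N}` on both sides, p. 13). [cite: MochizukiEtTh2009, §1 p.13] -/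
theorem haugN_of_map_GtpYN_eq (N : ℕ+)
    (hYN : (Dα.GtpYN N).map γ.toMulEquiv.toMonoidHom = Dβ.GtpYN N) (g : Dα.PiTemp) :
    Dβ.aug (γ.toMulEquiv g) ∈ Dβ.GKN N ↔ Dα.aug g ∈ Dα.GKN N := by
  constructor
  · intro h
    obtain ⟨g', hg', hge⟩ := exists_mem_GtpYN_aug_eq Dβ N h
    rw [← hYN] at hg'
    obtain ⟨x', hx', rfl⟩ := hg'
    have hx : Dα.aug x' = Dα.aug g := (aug_map_eq_iff Dα Dβ γ hΔ x' g).1 hge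
    rw [← hx]
    exact aug_mem_GKN_of_mem_GtpYN Dα N hx'
  · intro h
    obtain ⟨x', hx', hxe⟩ := exists_mem_GtpYN_aug_eq Dα N h
    have hmem : γ.toMulEquiv x' ∈ Dβ.GtpYN N := by rw [← hYN]; exact ⟨x', hx', rfl⟩
    have hx : Dβ.aug (γ.toMulEquiv x') = Dβ.aug (γ.toMulEquiv g) := (aug_map_eq_iff Dα Dβ γ hΔ x' g).2 hxe
    rw [← hx]
    exact aug_mem_GKN_of_mem_GtpYN Dβ N hmem

include hΔ in
/-- **Tightness of the new binder**: if `γ(Π^tp_{Z_N,α}) = Π^tp_{Z_N,β}` then the `G_{J_N}`-membership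
clause `haugJN` holds (`aug(Π^tp_{Z_N}) = G_{J_N}` on both sides, p. 14) — hZN ⇒ haugJN, so haugJN is a
necessary hypothesis of `map_GtpZN_eq_of_splitting`, not an idle one. [cite: MochizukiEtTh2009, §1 p.14] -/
theorem haugJN_of_map_GtpZN_eq (N : ℕ+)
    (hZN : (Dα.GtpZN N).map γ.toMulEquiv.toMonoidHom = Dβ.GtpZN N) (g : Dα.PiTemp) :
    Dβ.aug (γ.toMulEquiv g) ∈ Dβ.GJN N ↔ Dα.aug g ∈ Dα.GJN N := by
  constructor
  · intro h
    obtain ⟨g', hg', hge⟩ := exists_mem_GtpZN_aug_eq Dβ N h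
    rw [← hZN] at hg'
    obtain ⟨x', hx', rfl⟩ := hg'
    have hx : Dα.aug x' = Dα.aug g := (aug_map_eq_iff Dα Dβ γ hΔ x' g).1 hge
    rw [← hx]
    exact aug_mem_GJN_of_mem_GtpZN Dα N hx'
  · intro h
    obtain ⟨x', hx', hxe⟩ := exists_mem_GtpZN_aug_eq Dα N h
    have hmem : γ.toMulEquiv x' ∈ Dβ.GtpZN N := by rw [← hZN]; exact ⟨x', hx', rfl⟩
    have hx : Dβ.aug (γ.toMulEquiv x') = Dβ.aug (γ.toMulEquiv g) := (aug_map_eq_iff Dα Dβ γ hΔ x' g).2 hxe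
    rw [← hx]
    exact aug_mem_GJN_of_mem_GtpZN Dβ N hmem

include hΔ in
/-- A theta companion `γ^Θ` carries `(Δ^tp_{Yα})^Θ` onto `(Δ^tp_{Yβ})^Θ` (from (hΔ) and
`γ(Π^tp_{Yα}) = Π^tp_{Yβ}`, via L6-d5's `map_DtpY_eq`). [cite: MochizukiEtTh2009, Thm 1.6 (ii) p.24] -/
theorem map_DtpYTheta_eq (c : ThetaSetting.ThetaCompanion γ)
    (hY : Dα.GtpY.map γ.toMulEquiv.toMonoidHom = Dβ.GtpY) :
    Dα.DtpYTheta.map c.thetaIso.toMulEquiv.toMonoidHom = Dβ.DtpYTheta := by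
  change (Dα.DtpY.map Dα.toTheta).map _ = Dβ.DtpY.map Dβ.toTheta
  rw [← map_DtpY_eq Dα Dβ γ hΔ hY, Subgroup.map_map, Subgroup.map_map]
  congr 1
  ext x
  exact (c.comm x).symm

include hΔ in
/-- **`γ^Θ(N·(Δ^tp_{Yα})^Θ) = N·(Δ^tp_{Yβ})^Θ`** (p. 14 "`(Π^tp_{Y_N})^Θ/N·(Δ^tp_Y)^Θ`"): the subgroup
generated by `N`-th powers is carried along an isomorphism. [cite: MochizukiEtTh2009, §1 p.14] -/
theorem map_thetaPowersY_eq (c : ThetaSetting.ThetaCompanion γ)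
    (hY : Dα.GtpY.map γ.toMulEquiv.toMonoidHom = Dβ.GtpY) (N : ℕ+) :
    (Dα.thetaPowersY N).map c.thetaIso.toMulEquiv.toMonoidHom = Dβ.thetaPowersY N := by
  rw [ThetaSetting.thetaPowersY, ThetaSetting.thetaPowersY, MonoidHom.map_closure, ← Set.image_comp]
  have hpow : (c.thetaIso.toMulEquiv.toMonoidHom : Dα.GtpTheta → Dβ.GtpTheta) ∘
      (fun y : Dα.GtpTheta => y ^ (N : ℕ)) =
      (fun y : Dβ.GtpTheta => y ^ (N : ℕ)) ∘ c.thetaIso.toMulEquiv.toMonoidHom := by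
    funext y
    simp
  rw [hpow, Set.image_comp]
  congr 2
  exact congrArg SetLike.coe (map_DtpYTheta_eq Dα Dβ γ hΔ c hY)

include hΔ in
/-- **Transport of a lifted splitting** (p. 14 "any two splittings of this exact sequence …"): a lifted
splitting `s_α` over `G_{K_N,α}` of `(Π^tp_{Y_N,α})^Θ/N·(Δ^tp_{Yα})^Θ ↠ G_{K_N,α}` yields the lifted
splitting `s_β := γ^Θ ∘ s_α ∘ φ` over `G_{K_N,β}`, `φ(σ′) := aug_α(γ⁻¹ g′)` for any lift
`g′ ∈ Π^tp_{Y_N,β}` of `σ′`; and `s_β(aug_β(γ x)) = γ^Θ(s_α(aug_α x))`. Inputs: theta companion, (hΔ),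
`γ(Π^tp_{Yα}) = Π^tp_{Yβ}`, `γ(Π^tp_{Y_N,α}) = Π^tp_{Y_N,β}`, the `G_{K_N}`-membership transport.
[cite: MochizukiEtTh2009, §1 p.14] -/
theorem exists_transport_splitting (N : ℕ+) (c : ThetaSetting.ThetaCompanion γ)
    (hY : Dα.GtpY.map γ.toMulEquiv.toMonoidHom = Dβ.GtpY)
    (hYN : (Dα.GtpYN N).map γ.toMulEquiv.toMonoidHom = Dβ.GtpYN N)
    (haugN : ∀ g : Dα.PiTemp, Dβ.aug (γ.toMulEquiv g) ∈ Dβ.GKN N ↔ Dα.aug g ∈ Dα.GKN N)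
    {sα : ↥(Dα.GKN N) → Dα.GtpTheta} (hsα : Dα.IsThetaSplittingAt N sα) :
    ∃ sβ : ↥(Dβ.GKN N) → Dβ.GtpTheta, Dβ.IsThetaSplittingAt N sβ ∧
      ∀ (x : Dα.PiTemp) (hxα : Dα.aug x ∈ Dα.GKN N) (hxβ : Dβ.aug (γ.toMulEquiv x) ∈ Dβ.GKN N),
        sβ ⟨Dβ.aug (γ.toMulEquiv x), hxβ⟩ = c.thetaIso.toMulEquiv (sα ⟨Dα.aug x, hxα⟩) := by
  -- lifts of the elements of `G_{K_N,β}` to `Π^tp_{Y_N,β}`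
  choose lift hlift using fun σ' : ↥(Dβ.GKN N) => exists_mem_GtpYN_aug_eq Dβ N σ'.2
  -- the Galois correspondence `φ σ' := aug_α (γ⁻¹ (lift σ'))` lands in `G_{K_N,α}`
  have hφ : ∀ σ' : ↥(Dβ.GKN N), Dα.aug (γ.toMulEquiv.symm (lift σ')) ∈ Dα.GKN N := by
    intro σ'
    rw [← haugN, MulEquiv.apply_symm_apply, (hlift σ').2]
    exact σ'.2
  let φ : ↥(Dβ.GKN N) → ↥(Dα.GKN N) := fun σ' => ⟨Dα.aug (γ.toMulEquiv.symm (lift σ')), hφ σ'⟩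
  -- `φ (aug_β (γ x)) = aug_α x`
  have hφx : ∀ (x : Dα.PiTemp) (hxβ : Dβ.aug (γ.toMulEquiv x) ∈ Dβ.GKN N),
      (φ ⟨Dβ.aug (γ.toMulEquiv x), hxβ⟩ : GQp p) = Dα.aug x := by
    intro x hxβ
    change Dα.aug (γ.toMulEquiv.symm (lift ⟨Dβ.aug (γ.toMulEquiv x), hxβ⟩)) = Dα.aug x
    rw [← aug_map_eq_iff Dα Dβ γ hΔ, MulEquiv.apply_symm_apply]
    exact (hlift _).2
  -- `φ` is multiplicative
  have hφmul : ∀ σ' τ' : ↥(Dβ.GKN N), φ (σ' * τ') = φ σ' * φ τ' := by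
    intro σ' τ'
    apply Subtype.ext
    change Dα.aug (γ.toMulEquiv.symm (lift (σ' * τ'))) =
      Dα.aug (γ.toMulEquiv.symm (lift σ')) * Dα.aug (γ.toMulEquiv.symm (lift τ'))
    rw [← map_mul, ← map_mul, ← aug_map_eq_iff Dα Dβ γ hΔ, MulEquiv.apply_symm_apply,
      MulEquiv.apply_symm_apply, map_mul, (hlift (σ' * τ')).2, (hlift σ').2, (hlift τ').2]
    rfl
  -- lifts on the `α` side along `sα`
  choose gα hgα using fun σ : ↥(Dα.GKN N) => hsα.exists_lift σ
  refine ⟨fun σ' => c.thetaIso.toMulEquiv (sα (φ σ')), ⟨fun σ' => ?_, fun σ' τ' => ?_⟩,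
    fun x hxα hxβ => ?_⟩
  · -- `s_β(σ')` is the image of `γ (gα (φ σ')) ∈ Π^tp_{Y_N,β}`, which lies over `σ'`
    refine ⟨γ.toMulEquiv (gα (φ σ')), ?_, ?_, ?_⟩
    · rw [← hYN]
      exact ⟨_, (hgα _).1, rfl⟩
    · have h1 : Dα.aug (gα (φ σ')) = Dα.aug (γ.toMulEquiv.symm (lift σ')) := (hgα _).2.1
      rw [← aug_map_eq_iff Dα Dβ γ hΔ, MulEquiv.apply_symm_apply, (hlift σ').2] at h1
      exact h1
    · rw [c.comm, (hgα _).2.2]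
  · -- multiplicativity modulo `N·(Δ^tp_{Yβ})^Θ`
    have hm := hsα.map_mul_mem (φ σ') (φ τ')
    rw [← hφmul] at hm
    have hm' : c.thetaIso.toMulEquiv (sα (φ (σ' * τ')) * (sα (φ σ') * sα (φ τ'))⁻¹) ∈
        Dβ.thetaPowersY N := by
      rw [← map_thetaPowersY_eq Dα Dβ γ hΔ c hY N]
      exact ⟨_, hm, rfl⟩
    simpa only [map_mul, map_inv] using hm'
  · -- the value at `aug_β (γ x)`
    have hu : φ ⟨Dβ.aug (γ.toMulEquiv x), hxβ⟩ = ⟨Dα.aug x, hxα⟩ := Subtype.ext (hφx x hxβ)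
    change c.thetaIso.toMulEquiv (sα (φ ⟨Dβ.aug (γ.toMulEquiv x), hxβ⟩)) = _
    rw [hu]

include hΔ in
/-- **`γ(Π^tp_{Z_N,α}) = Π^tp_{Z_N,β}` from print's construction of `Z_N`** (p. 14), ∃-form on the
`α` side: inputs — a theta companion `γ^Θ`; (hΔ) `γ(Δ^tp_{Xα}) = Δ^tp_{Xβ}` ([AbsAnab] Lem. 1.3.8);
`γ(Π^tp_{Yα}) = Π^tp_{Yβ}` (leaf L02); `γ(Π^tp_{Y_N,α}) = Π^tp_{Y_N,β}` (L6-d5's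
`map_GtpYN_eq_of_inputs`); the transports of "`aug g ∈ G_{K_N}`" (leaf L04) and of "`aug g ∈ G_{J_N}`"
(its `J_N`-twin: "`G_{J_N}` is group-theoretic" — in print, Kummer theory of `K_N`, "[by the definition
of `J_N`]"); on the `α` side SOME lifted splitting for which the printed characterisation of
`Π^tp_{Z_N,α}` holds; on the `β` side the clause `GtpZNFromSplitting Dβ N` (every lifted splitting cuts
out `Π^tp_{Z_N,β}`). [cite: MochizukiEtTh2009, §1 p.14] -/
theorem map_GtpZN_eq_of_exists_splitting (N : ℕ+) (c : ThetaSetting.ThetaCompanion γ)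
    (hY : Dα.GtpY.map γ.toMulEquiv.toMonoidHom = Dβ.GtpY)
    (hYN : (Dα.GtpYN N).map γ.toMulEquiv.toMonoidHom = Dβ.GtpYN N)
    (haugN : ∀ g : Dα.PiTemp, Dβ.aug (γ.toMulEquiv g) ∈ Dβ.GKN N ↔ Dα.aug g ∈ Dα.GKN N)
    (haugJN : ∀ g : Dα.PiTemp, Dβ.aug (γ.toMulEquiv g) ∈ Dβ.GJN N ↔ Dα.aug g ∈ Dα.GJN N)
    (hzα : ∃ sα : ↥(Dα.GKN N) → Dα.GtpTheta, Dα.IsThetaSplittingAt N sα ∧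
      ∀ g : Dα.PiTemp, g ∈ Dα.GtpZN N ↔
        g ∈ Dα.GtpYN N ∧ ∃ h : Dα.aug g ∈ Dα.GJN N,
          Dα.toTheta g * (sα ⟨Dα.aug g, Dα.GJN_le_GKN N h⟩)⁻¹ ∈ Dα.thetaPowersY N)
    (hzβ : Dβ.GtpZNFromSplitting N) :
    (Dα.GtpZN N).map γ.toMulEquiv.toMonoidHom = Dβ.GtpZN N := by
  obtain ⟨sα, hsα, hZα⟩ := hzα
  obtain ⟨sβ, hsβ, hsβx⟩ := exists_transport_splitting Dα Dβ γ hΔ N c hY hYN haugN hsα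
  have hZβ := hzβ sβ hsβ
  have hYx : ∀ x : Dα.PiTemp, γ.toMulEquiv x ∈ Dβ.GtpYN N ↔ x ∈ Dα.GtpYN N := fun x => by
    rw [← hYN]
    exact mem_map_iff_of_equiv Dα Dβ γ _ x
  ext y
  obtain ⟨x, rfl⟩ := γ.toMulEquiv.surjective y
  rw [mem_map_iff_of_equiv, hZα x, hZβ (γ.toMulEquiv x)]
  constructor
  · rintro ⟨hxY, hxJ, hmem⟩
    have hxJβ : Dβ.aug (γ.toMulEquiv x) ∈ Dβ.GJN N := (haugJN x).2 hxJ
    refine ⟨(hYx x).2 hxY, hxJβ, ?_⟩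
    rw [hsβx x (Dα.GJN_le_GKN N hxJ) (Dβ.GJN_le_GKN N hxJβ), c.comm, ← map_inv, ← map_mul,
      ← map_thetaPowersY_eq Dα Dβ γ hΔ c hY N]
    exact ⟨_, hmem, rfl⟩
  · rintro ⟨hxY, hxJβ, hmem⟩
    have hxJ : Dα.aug x ∈ Dα.GJN N := (haugJN x).1 hxJβ
    refine ⟨(hYx x).1 hxY, hxJ, ?_⟩
    rw [hsβx x (Dα.GJN_le_GKN N hxJ) (Dβ.GJN_le_GKN N hxJβ), c.comm, ← map_inv, ← map_mul,
      ← map_thetaPowersY_eq Dα Dβ γ hΔ c hY N] at hmem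
    obtain ⟨z, hz, hze⟩ := hmem
    rwa [← c.thetaIso.toMulEquiv.injective hze]

include hΔ in
/-- **`γ(Π^tp_{Z_N,α}) = Π^tp_{Z_N,β}`** with the origin clause `GtpZNFromSplitting` (p446335) on BOTH
sides and the existence of a lifted splitting on the `α` side (p. 14: splittings exist and "all
splittings … determine the same splitting over `G_{J_N}`") — the `Z_N`-twin of L6-d5's
`map_GtpYN_eq_of_inputs`; supplies the hypothesis hZN of `IsInversionAut.transport` /
`thm16iii_of_prop15iiiInv`. [cite: MochizukiEtTh2009, §1 p.14] -/
theorem map_GtpZN_eq_of_splitting (N : ℕ+) (c : ThetaSetting.ThetaCompanion γ)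
    (hY : Dα.GtpY.map γ.toMulEquiv.toMonoidHom = Dβ.GtpY)
    (hYN : (Dα.GtpYN N).map γ.toMulEquiv.toMonoidHom = Dβ.GtpYN N)
    (haugN : ∀ g : Dα.PiTemp, Dβ.aug (γ.toMulEquiv g) ∈ Dβ.GKN N ↔ Dα.aug g ∈ Dα.GKN N)
    (haugJN : ∀ g : Dα.PiTemp, Dβ.aug (γ.toMulEquiv g) ∈ Dβ.GJN N ↔ Dα.aug g ∈ Dα.GJN N)
    (hzα : Dα.GtpZNFromSplitting N) (hsα : ∃ s, Dα.IsThetaSplittingAt N s)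
    (hzβ : Dβ.GtpZNFromSplitting N) :
    (Dα.GtpZN N).map γ.toMulEquiv.toMonoidHom = Dβ.GtpZN N :=
  hsα.elim fun s hs =>
    map_GtpZN_eq_of_exists_splitting Dα Dβ γ hΔ N c hY hYN haugN haugJN ⟨s, hs, hzα s hs⟩ hzβ

end TwoSettings

/-! ### One setting: an automorphism over `K` -/

section OneSettingAut

variable (D : ThetaSetting p) (ι : D.PiTemp ≃ₜ* D.PiTemp)
  (haug : ∀ g : D.PiTemp, D.aug (ι g) = D.aug g)

include haug in
/-- For an automorphism over `K`, every Galois-image clause transports trivially.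
[cite: MochizukiEtTh2009, Prop 1.5 (iii) p.23] -/
theorem aug_mem_iff_of_aug_apply (S : Subgroup (GQp p)) (g : D.PiTemp) :
    D.aug (ι.toMulEquiv g) ∈ S ↔ D.aug g ∈ S := by
  change D.aug (ι g) ∈ S ↔ _
  rw [haug]

/-- An automorphism acting by `−1` on `Z` preserves `Π^tp_Y = Ker(Π^tp_X ↠ Z)` (p. 12).
[cite: MochizukiEtTh2009, §1 p.12] -/
theorem map_GtpY_eq_of_toZ_apply (htoZ : ∀ g : D.PiTemp, D.toZ (ι g) = (D.toZ g)⁻¹) :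
    D.GtpY.map ι.toMulEquiv.toMonoidHom = D.GtpY := by
  have key : ∀ y : D.PiTemp, ι y ∈ D.GtpY ↔ y ∈ D.GtpY := fun y => by
    change ι y ∈ D.toZ.ker ↔ y ∈ D.toZ.ker
    rw [MonoidHom.mem_ker, MonoidHom.mem_ker, htoZ, inv_eq_one]
  ext x
  refine ⟨?_, fun hx => ⟨ι.symm x, (key _).1 (by rwa [ι.apply_symm_apply]), ι.apply_symm_apply x⟩⟩
  rintro ⟨y, hy, rfl⟩
  exact (key y).2 hy

include haug in
/-- **`ι(Π^tp_{Z_N}) = Π^tp_{Z_N}` for an automorphism `ι` over `K`** with theta companion, preserving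
`Π^tp_Y` and `Π^tp_{Y_N}`, at a setting satisfying the origin clause `GtpZNFromSplitting` at level `N`
with a lifted splitting (p. 14). [cite: MochizukiEtTh2009, §1 p.14] -/
theorem map_GtpZN_eq_self_of_splitting (N : ℕ+) (c : ThetaSetting.ThetaCompanion ι)
    (hY : D.GtpY.map ι.toMulEquiv.toMonoidHom = D.GtpY)
    (hYN : (D.GtpYN N).map ι.toMulEquiv.toMonoidHom = D.GtpYN N)
    (hz : D.GtpZNFromSplitting N) (hs : ∃ s, D.IsThetaSplittingAt N s) :
    (D.GtpZN N).map ι.toMulEquiv.toMonoidHom = D.GtpZN N :=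
  map_GtpZN_eq_of_splitting D D ι (D.map_deltaTemp_eq_of_aug_comp ι haug) N c hY hYN
    (fun g => aug_mem_iff_of_aug_apply D ι haug _ g) (fun g => aug_mem_iff_of_aug_apply D ι haug _ g)
    hz hs hz

end OneSettingAut

end Thm16Sub

namespace ThetaSetting

variable {p : ℕ} [Fact p.Prime] (D : ThetaSetting p) (ι : D.PiTemp ≃ₜ* D.PiTemp)

/-- **`IsInversionAut` from origin clauses** (Prop. 1.5 (iii), p. 23 "an automorphism lying over the
action of “−1” on the underlying elliptic curve"; pp. 13–14, the constructions of `Y_N`, `Z_N`): for an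
automorphism `ι` of `Π^tp_X` over `K`, acting by `−1` on `Z` and on `(Δ^tp_X)^ell`, with a theta
companion, the covering fields `map_GtpYN` / `map_GtpZN` of `IsInversionAut` are THEOREMS of: the
construction of `Y_N` from a cusp section at every level (`Thm16Sub.GtpYNFromCusp`, R2), [SemiAnbd]
Thm. 6.5 (iii) for automorphisms of `Π^tp_X` (`IsoPreservesCuspidalDecomp`), a cuspidal decomposition
group inside `Π^tp_Y`, the construction of `Z_N` (`GtpZNFromSplitting`) and a lifted splitting at every
level. [cite: MochizukiEtTh2009, Prop 1.5 (iii) p.23] -/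
theorem isInversionAut_of_originClauses (c : ThetaCompanion ι)
    (haug : ∀ g : D.PiTemp, D.aug (ι g) = D.aug g)
    (htoZ : ∀ g : D.PiTemp, D.toZ (ι g) = (D.toZ g)⁻¹)
    (hell : ∀ g ∈ D.DeltaTemp, D.thetaToEll (D.toTheta (ι g)) = (D.thetaToEll (D.toTheta g))⁻¹)
    (hcusp : ∀ N, Thm16Sub.GtpYNFromCusp D N) (h65 : D.IsoPreservesCuspidalDecomp D.toTemperedCurve)
    (hex : ∃ Dc : Subgroup D.PiTemp, D.IsCuspidalDecompositionGroup Dc ∧ Dc ≤ D.GtpY)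
    (hz : ∀ N, D.GtpZNFromSplitting N) (hs : ∀ N, ∃ s, D.IsThetaSplittingAt N s) :
    D.IsInversionAut ι := by
  have hΔ : D.DeltaTemp.map ι.toMulEquiv.toMonoidHom = D.DeltaTemp := D.map_deltaTemp_eq_of_aug_comp ι haug
  have hY : D.GtpY.map ι.toMulEquiv.toMonoidHom = D.GtpY := Thm16Sub.map_GtpY_eq_of_toZ_apply D ι htoZ
  have hYN : ∀ N, (D.GtpYN N).map ι.toMulEquiv.toMonoidHom = D.GtpYN N := fun N =>
    Thm16Sub.map_GtpYN_eq_of_inputs D D ι hΔ N hY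
      (fun g => Thm16Sub.aug_mem_iff_of_aug_apply D ι haug _ g) (hcusp N) (hcusp N) h65 hex
  exact ⟨haug, htoZ, hell, hYN, fun N =>
    Thm16Sub.map_GtpZN_eq_self_of_splitting D ι haug N c hY (hYN N) (hz N) (hs N)⟩

end ThetaSetting

end Literature.AnabelianGeometry.EtaleTheta

end
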